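import Literature.Probability.RandomPlanarGeometry.RadialBesselExit
import HarnessLib

/-!
# The radial Bessel flow: order preservation and contraction in the starting point

Topic `Probability/RandomPlanarGeometry`; theorems only, sequel of `RadialBesselFlow` /
`RadialBesselExit`. For ONE continuous driving path and two starting points `θ₁ ≤ θ₂`, the radial
Bessel flows `Yₜ = θ + ∫₀ᵗ cot(Y_s/2) ds - (Uₜ - U₀)` driven by the same `U` are **ordered**,
`Y^{θ₁} ≤ Y^{θ₂}`, and their **gap `Y^{θ₂} - Y^{θ₁}` is non-increasing** in time: the drift
`cot(y/2)` is decreasing in `y`, so `d/dt (Y^{θ₂} - Y^{θ₁}) = cot(Y^{θ₂}/2) - cot(Y^{θ₁}/2) ≤ 0`.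
This is Lawler (2005), §1.11.2 ("we will consider a family of processes `X_t^x` all satisfying
(1.16) with the same Brownian motion … if `x < y`, then `X_t^x < X_t^y` for all `t < T^x`",
and `d/dt [X_t^y - X_t^x] = (a/2)[cot(X_t^y/2) - cot(X_t^x/2)] ≤ …`, p. 39–40), stated here for
the truncated flows of every level (`argTrunc_mono`, `sub_argTrunc_antitone`), for the maximal
flow below both lifetimes (`arg_mono`, `arg_sub_arg_mem_Icc`), and for the exit data: a top exit of
the lower flow forces an earlier top exit of the upper flow (`topAt_mono`), a bottom exit of the
upper flow forces an earlier bottom exit of the lower flow (`botAt_anti`), whence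
`ExitsTop θ₁ → ExitsTop θ₂` and `ExitsBot θ₂ → ExitsBot θ₁` (`exitsTop_mono`, `exitsBot_anti`) —
the pathwise monotonicity in `θ` behind the monotonicity of LSW's `h(θ, t)` in `θ`
(`Q(θ₁) ⊆ Q(θ₂)`).

## References

* G. F. Lawler, *Conformally Invariant Processes in the Plane*, AMS (2005), §1.11.2 (pp. 39–40).
  [Lawler2005]
* G. F. Lawler, O. Schramm, W. Werner, *One-arm exponent for critical 2D percolation*, Electron.
  J. Probab. 7 (2002), no. 2, §2. [LawlerSchrammWernerEJP2002]
-/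

noncomputable section

open Set Filter Topology MeasureTheory Metric

namespace Literature.Probability.RandomPlanarGeometry

namespace RadialLoewner

open scoped NNReal

variable {Ω : Type*} {mΩ : MeasurableSpace Ω} {U : Ω → ℝ≥0 → ℝ}

/-! ### The clamped drift is decreasing -/

section Antitone

variable {δ : ℝ}

/-- The clamp is monotone. [folklore] -/
theorem clampI_mono (δ : ℝ) : Monotone (clampI δ) := fun _ _ h ↦
  max_le_max le_rfl (min_le_min h le_rfl)

/-- `cot` is decreasing on `[δ, π - δ]` (`0 < δ`): `cot a - cot b = sin(b - a)/(sin a sin b) ≥ 0`.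
[folklore] -/
theorem cot_le_cot_of_mem (hδ : 0 < δ) {a b : ℝ} (ha : a ∈ Icc δ (Real.pi - δ))
    (hb : b ∈ Icc δ (Real.pi - δ)) (hab : a ≤ b) : Real.cot b ≤ Real.cot a := by
  have hsa := sin_pos_of_mem hδ ha
  have hsb := sin_pos_of_mem hδ hb
  have h := cot_sub_cot hsa.ne' hsb.ne'
  have hnum : 0 ≤ Real.sin (b - a) :=
    Real.sin_nonneg_of_nonneg_of_le_pi (by linarith) (by linarith [ha.1, hb.2])
  have : 0 ≤ Real.cot a - Real.cot b := by rw [h]; positivity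
  linarith

/-- **The clamped cotangent is decreasing** (`0 < δ ≤ π/2`). [folklore] -/
theorem cotTrunc_antitone (hδ : 0 < δ) (hδ' : δ ≤ Real.pi / 2) : Antitone (cotTrunc δ) :=
  fun _ _ hxy ↦ cot_le_cot_of_mem hδ (clampI_mem hδ' _) (clampI_mem hδ' _) (clampI_mono δ hxy)

/-- The truncated radial field is decreasing in the space variable. [folklore] -/
theorem radialField_antitone {V : ℝ≥0 → ℝ} (hδ : 0 < δ) (hδ' : δ ≤ Real.pi / 2) (s : ℝ) :
    Antitone (radialField V δ s) := fun _ _ h ↦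
  cotTrunc_antitone hδ hδ' (div_le_div_of_nonneg_right (sub_le_sub_right h _) zero_le_two)

end Antitone

/-! ### Order preservation and contraction for the truncated flows -/

section Truncated

variable (hc : ∀ ω, Continuous (U ω)) {δ : ℝ} (hδ : 0 < δ) (hδ' : δ ≤ Real.pi / 2)
include hc hδ hδ'

/-- **No crossing**: two truncated solutions of the same level on `[0, t]` that are ordered at
time `0` stay ordered (if they met, forward uniqueness would make them coincide afterwards).
[folklore] -/
theorem truncSol_mono {t : ℝ≥0} {θ₁ θ₂ : ℝ} (hθ : θ₁ ≤ θ₂) (ω : Ω) {s : ℝ} (hs : s ∈ Icc (0 : ℝ) t) :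
    truncSol (t := t) hc hδ hδ' θ₁ ω s ≤ truncSol (t := t) hc hδ hδ' θ₂ ω s := by
  set Z₁ := truncSol (t := t) hc hδ hδ' θ₁ ω with hZ₁
  set Z₂ := truncSol (t := t) hc hδ hδ' θ₂ ω with hZ₂
  have hder₁ : ∀ r ∈ Icc (0 : ℝ) t, HasDerivWithinAt Z₁ (radialField (U ω) δ r (Z₁ r)) (Icc (0 : ℝ) t) r :=
    fun r hr ↦ hasDerivWithinAt_truncSol hc hδ hδ' θ₁ ω hr
  have hder₂ : ∀ r ∈ Icc (0 : ℝ) t, HasDerivWithinAt Z₂ (radialField (U ω) δ r (Z₂ r)) (Icc (0 : ℝ) t) r :=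
    fun r hr ↦ hasDerivWithinAt_truncSol hc hδ hδ' θ₂ ω hr
  have hcont : ContinuousOn (fun r ↦ Z₂ r - Z₁ r) (Icc (0 : ℝ) t) := fun r hr ↦
    (hder₂ r hr).continuousWithinAt.sub (hder₁ r hr).continuousWithinAt
  by_contra hlt
  rw [not_le] at hlt
  -- the gap is `≥ 0` at `0` and `< 0` at `s`: it vanishes at some `s₁ ∈ [0, s]`
  have h0 : 0 ≤ Z₂ 0 - Z₁ 0 := by rw [hZ₁, hZ₂, truncSol_zero, truncSol_zero]; linarith
  have hs0 : Z₂ s - Z₁ s < 0 := by linarith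
  obtain ⟨s₁, hs₁, hgap⟩ : ∃ s₁ ∈ Icc (0 : ℝ) s, Z₂ s₁ - Z₁ s₁ = 0 :=
    intermediate_value_Icc' hs.1 (hcont.mono (Icc_subset_Icc le_rfl hs.2)) ⟨hs0.le, h0⟩
  -- forward uniqueness from `s₁`
  have hsub : Icc s₁ (t : ℝ) ⊆ Icc (0 : ℝ) t := Icc_subset_Icc hs₁.1 le_rfl
  have hIci : ∀ {Z : ℝ → ℝ}, (∀ r ∈ Icc (0 : ℝ) t, HasDerivWithinAt Z (radialField (U ω) δ r (Z r))
      (Icc (0 : ℝ) t) r) → ∀ r ∈ Ico s₁ (t : ℝ), HasDerivWithinAt Z (radialField (U ω) δ r (Z r)) (Ici r) r :=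
    fun hZ r hr ↦ (hZ r ⟨hs₁.1.trans hr.1, hr.2.le⟩).mono_of_mem_nhdsWithin
      (mem_of_superset (Icc_mem_nhdsGE hr.2) (Icc_subset_Icc (hs₁.1.trans hr.1) le_rfl))
  have hEq := ODE_solution_unique (v := radialField (U ω) δ)
    (K := (1 / (2 * Real.sin δ ^ 2)).toNNReal) (fun r ↦ lipschitzWith_radialField hδ hδ' r)
    (a := s₁) (b := t) (f := Z₁) (g := Z₂)
    (fun r hr ↦ (hder₁ r (hsub hr)).continuousWithinAt.mono hsub) (hIci hder₁)
    (fun r hr ↦ (hder₂ r (hsub hr)).continuousWithinAt.mono hsub) (hIci hder₂) (by linarith)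
  have := hEq ⟨hs₁.2, hs.2⟩
  linarith

/-- **Order preservation** (Lawler (2005), §1.11.2: "if `x < y`, then `X_t^x < X_t^y`"): for one
driving path and `θ₁ ≤ θ₂`, the level-`δ` flows satisfy `Y^{θ₁}ₜ ≤ Y^{θ₂}ₜ` for all `t`.
[cite: Lawler2005, §1.11.2] -/
theorem argTrunc_mono {θ₁ θ₂ : ℝ} (hθ : θ₁ ≤ θ₂) (ω : Ω) (t : ℝ≥0) :
    argTrunc U δ hc hδ hδ' θ₁ t ω ≤ argTrunc U δ hc hδ hδ' θ₂ t ω := by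
  rw [argTrunc_eq_of_le hc hδ hδ' θ₁ ω le_rfl, argTrunc_eq_of_le hc hδ hδ' θ₂ ω le_rfl]
  linarith [truncSol_mono hc hδ hδ' hθ ω (t := t) ⟨t.coe_nonneg, le_rfl⟩]

/-- **Contraction** (Lawler (2005), §1.11.2: "`d/dt [X_t^y - X_t^x] = (a/2)[cot(X_t^y/2) -
cot(X_t^x/2)]`", which is `≤ 0`): for `θ₁ ≤ θ₂` the gap `Y^{θ₂}ₜ - Y^{θ₁}ₜ` of the level-`δ` flows
is non-increasing in `t` (the driving terms cancel and the drift is decreasing).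
[cite: Lawler2005, §1.11.2] -/
theorem sub_argTrunc_antitone {θ₁ θ₂ : ℝ} (hθ : θ₁ ≤ θ₂) (ω : Ω) :
    Antitone fun t ↦ argTrunc U δ hc hδ hδ' θ₂ t ω - argTrunc U δ hc hδ hδ' θ₁ t ω := by
  intro t₁ t₂ ht
  -- work on the horizon `[0, t₂]` with the truncated solutions
  set Z₁ := truncSol (t := t₂) hc hδ hδ' θ₁ ω with hZ₁
  set Z₂ := truncSol (t := t₂) hc hδ hδ' θ₂ ω with hZ₂
  have hder : ∀ r ∈ Icc (0 : ℝ) t₂, HasDerivWithinAt (fun r ↦ Z₂ r - Z₁ r)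
      (radialField (U ω) δ r (Z₂ r) - radialField (U ω) δ r (Z₁ r)) (Icc (0 : ℝ) t₂) r := fun r hr ↦
    (hasDerivWithinAt_truncSol hc hδ hδ' θ₂ ω hr).sub (hasDerivWithinAt_truncSol hc hδ hδ' θ₁ ω hr)
  have hanti : AntitoneOn (fun r ↦ Z₂ r - Z₁ r) (Icc (0 : ℝ) t₂) := by
    refine antitoneOn_of_hasDerivWithinAt_nonpos (convex_Icc _ _)
      (fun r hr ↦ (hder r hr).continuousWithinAt)
      (fun r hr ↦ (hder r (interior_subset hr)).mono interior_subset) fun r hr ↦ ?_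
    have hr' := interior_subset hr
    have hle := truncSol_mono hc hδ hδ' hθ ω (t := t₂) hr'
    linarith [radialField_antitone (V := U ω) hδ hδ' r hle]
  have h1 : argTrunc U δ hc hδ hδ' θ₂ t₁ ω - argTrunc U δ hc hδ hδ' θ₁ t₁ ω = Z₂ t₁ - Z₁ t₁ := by
    rw [argTrunc_eq_of_le hc hδ hδ' θ₁ ω ht, argTrunc_eq_of_le hc hδ hδ' θ₂ ω ht]; ring
  have h2 : argTrunc U δ hc hδ hδ' θ₂ t₂ ω - argTrunc U δ hc hδ hδ' θ₁ t₂ ω = Z₂ t₂ - Z₁ t₂ := by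
    rw [argTrunc_eq_of_le hc hδ hδ' θ₁ ω le_rfl, argTrunc_eq_of_le hc hδ hδ' θ₂ ω le_rfl]; ring
  simp only
  rw [h1, h2]
  exact hanti ⟨t₁.coe_nonneg, by exact_mod_cast ht⟩ ⟨t₂.coe_nonneg, le_rfl⟩ (by exact_mod_cast ht)

/-- The gap is at most the initial gap: `0 ≤ Y^{θ₂}ₜ - Y^{θ₁}ₜ ≤ θ₂ - θ₁`. [folklore] -/
theorem sub_argTrunc_mem_Icc {θ₁ θ₂ : ℝ} (hθ : θ₁ ≤ θ₂) (ω : Ω) (t : ℝ≥0) :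
    argTrunc U δ hc hδ hδ' θ₂ t ω - argTrunc U δ hc hδ hδ' θ₁ t ω ∈ Icc 0 (θ₂ - θ₁) := by
  refine ⟨sub_nonneg.2 (argTrunc_mono hc hδ hδ' hθ ω t), ?_⟩
  have h := sub_argTrunc_antitone hc hδ hδ' hθ ω (show (0 : ℝ≥0) ≤ t from zero_le)
  simp only [argTrunc_zero] at h
  exact h

/-! ### Exit data: top exits propagate upwards, bottom exits downwards -/

/-- **A top exit of the lower flow forces an earlier top exit of the upper flow** (same level,
both starts inside): if `θ₁ ≤ θ₂` and `Y^{θ₁}` exits `(2δ, 2π - 2δ)` at time `s` through the top,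
then `σ_δ(θ₂) ≤ s` and `Y^{θ₂}` exits through the top. [folklore] -/
theorem truncExit_le_of_top {θ₁ θ₂ : ℝ} (hθ : θ₁ ≤ θ₂)
    (hθ₂ : θ₂ ∈ Ioo (2 * δ) (2 * Real.pi - 2 * δ)) (ω : Ω) {s : ℝ≥0}
    (hs : truncExit U hc hδ hδ' θ₁ ω = s) (htop : argTrunc U δ hc hδ hδ' θ₁ s ω = 2 * Real.pi - 2 * δ) :
    ∃ s' : ℝ≥0, s' ≤ s ∧ truncExit U hc hδ hδ' θ₂ ω = s' ∧
      argTrunc U δ hc hδ hδ' θ₂ s' ω = 2 * Real.pi - 2 * δ := by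
  -- `Y^{θ₂}(s) ≥ 2π - 2δ`, so `σ(θ₂) ≤ s`
  have hge : 2 * Real.pi - 2 * δ ≤ argTrunc U δ hc hδ hδ' θ₂ s ω :=
    htop ▸ argTrunc_mono hc hδ hδ' hθ ω s
  have hle : truncExit U hc hδ hδ' θ₂ ω ≤ s :=
    (Process.exitTime_le_coe_iff (continuous_argTrunc hc hδ hδ' θ₂ ω)).2
      ⟨s, le_rfl, fun h ↦ not_lt.2 hge h.2⟩
  obtain ⟨s', hs'⟩ := WithTop.ne_top_iff_exists.1 (ne_top_of_le_ne_top WithTop.coe_ne_top hle)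
  have hs's : s' ≤ s := by rw [← hs'] at hle; exact WithTop.coe_le_coe.1 hle
  refine ⟨s', hs's, hs'.symm, ?_⟩
  rcases argTrunc_truncExit_eq_or hc hδ hδ' hθ₂ ω hs'.symm with hbot | htop'
  · -- a bottom exit of the upper flow at `s' ≤ s` would drag the lower flow below `2δ` before `s`
    exfalso
    have hle₁ : argTrunc U δ hc hδ hδ' θ₁ s' ω ≤ 2 * δ := hbot ▸ argTrunc_mono hc hδ hδ' hθ ω s'
    have hin : ((s' : ℝ≥0) : WithTop ℝ≥0) ≤ truncExit U hc hδ hδ' θ₁ ω := by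
      rw [hs]; exact WithTop.coe_le_coe.2 hs's
    have hθ₁ : θ₁ ∈ Ioo (2 * δ) (2 * Real.pi - 2 * δ) := by
      refine ⟨?_, hθ.trans_lt hθ₂.2⟩
      -- `θ₁ > 2δ`: otherwise `σ(θ₁) = 0` and `Y^{θ₁}(σ) = θ₁ ≠ 2π - 2δ`
      by_contra hnot
      rw [not_lt] at hnot
      have h0 : truncExit U hc hδ hδ' θ₁ ω = 0 :=
        le_antisymm ((Process.exitTime_le_coe_iff (continuous_argTrunc hc hδ hδ' θ₁ ω)).2
          ⟨0, le_rfl, fun h ↦ not_lt.2 hnot (by rw [argTrunc_zero] at h; exact h.1)⟩) bot_le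
      rw [h0] at hs
      have hs0 : s = 0 := by exact_mod_cast hs.symm
      rw [hs0, argTrunc_zero] at htop
      have : δ ≤ 1 * δ := by linarith
      linarith [hθ₂.2, hnot]
    rcases hs's.eq_or_lt with heq | hlt
    · rw [heq] at hle₁
      have : 2 * δ < 2 * Real.pi - 2 * δ := hθ₂.1.trans hθ₂.2
      linarith [hle₁, htop.symm.le]
    · have hin' : ((s' : ℝ≥0) : WithTop ℝ≥0) < truncExit U hc hδ hδ' θ₁ ω := by
        rw [hs]; exact WithTop.coe_lt_coe.2 hlt
      have hmem := argTrunc_mem_Ioo_of_lt_truncExit hc hδ hδ' θ₁ ω hin'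
      linarith [hmem.1]
  · exact htop'

/-- **A bottom exit of the upper flow forces an earlier bottom exit of the lower flow** (same
level, both starts inside). [folklore] -/
theorem truncExit_le_of_bot {θ₁ θ₂ : ℝ} (hθ : θ₁ ≤ θ₂)
    (hθ₁ : θ₁ ∈ Ioo (2 * δ) (2 * Real.pi - 2 * δ)) (ω : Ω) {s : ℝ≥0}
    (hs : truncExit U hc hδ hδ' θ₂ ω = s) (hbot : argTrunc U δ hc hδ hδ' θ₂ s ω = 2 * δ) :
    ∃ s' : ℝ≥0, s' ≤ s ∧ truncExit U hc hδ hδ' θ₁ ω = s' ∧ argTrunc U δ hc hδ hδ' θ₁ s' ω = 2 * δ := by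
  have hle₁ : argTrunc U δ hc hδ hδ' θ₁ s ω ≤ 2 * δ := hbot ▸ argTrunc_mono hc hδ hδ' hθ ω s
  have hle : truncExit U hc hδ hδ' θ₁ ω ≤ s :=
    (Process.exitTime_le_coe_iff (continuous_argTrunc hc hδ hδ' θ₁ ω)).2
      ⟨s, le_rfl, fun h ↦ not_lt.2 hle₁ h.1⟩
  obtain ⟨s', hs'⟩ := WithTop.ne_top_iff_exists.1 (ne_top_of_le_ne_top WithTop.coe_ne_top hle)
  have hs's : s' ≤ s := by rw [← hs'] at hle; exact WithTop.coe_le_coe.1 hle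
  refine ⟨s', hs's, hs'.symm, ?_⟩
  rcases argTrunc_truncExit_eq_or hc hδ hδ' hθ₁ ω hs'.symm with hbot' | htop
  · exact hbot'
  · exfalso
    have hge₂ : 2 * Real.pi - 2 * δ ≤ argTrunc U δ hc hδ hδ' θ₂ s' ω := htop ▸ argTrunc_mono hc hδ hδ' hθ ω s'
    have hθ₂ : θ₂ ∈ Ioo (2 * δ) (2 * Real.pi - 2 * δ) := by
      refine ⟨hθ₁.1.trans_le hθ, ?_⟩
      by_contra hnot
      rw [not_lt] at hnot
      have h0 : truncExit U hc hδ hδ' θ₂ ω = 0 :=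
        le_antisymm ((Process.exitTime_le_coe_iff (continuous_argTrunc hc hδ hδ' θ₂ ω)).2
          ⟨0, le_rfl, fun h ↦ not_lt.2 hnot (by rw [argTrunc_zero] at h; exact h.2)⟩) bot_le
      rw [h0] at hs
      have hs0 : s = 0 := by exact_mod_cast hs.symm
      rw [hs0, argTrunc_zero] at hbot
      linarith [hθ₁.1]
    rcases hs's.eq_or_lt with heq | hlt
    · rw [heq] at hge₂
      have : 2 * δ < 2 * Real.pi - 2 * δ := hθ₁.1.trans hθ₁.2
      linarith [hge₂, hbot.le]
    · have hin' : ((s' : ℝ≥0) : WithTop ℝ≥0) < truncExit U hc hδ hδ' θ₂ ω := by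
        rw [hs]; exact WithTop.coe_lt_coe.2 hlt
      have hmem := argTrunc_mem_Ioo_of_lt_truncExit hc hδ hδ' θ₂ ω hin'
      linarith [hmem.2]

end Truncated

/-! ### The maximal flows and the exit sides -/

section Maximal

variable (hc : ∀ ω, Continuous (U ω))
include hc

/-- **Order preservation for the radial Bessel flows** below both lifetimes: for `θ₁ ≤ θ₂` and
`t ≤ σₙ(θ₁) ∧ σₙ(θ₂)` (some level `n`), `Y^{θ₁}ₜ ≤ Y^{θ₂}ₜ`. [cite: Lawler2005, §1.11.2] -/
theorem arg_mono {θ₁ θ₂ : ℝ} (hθ : θ₁ ≤ θ₂) {ω : Ω} {t : ℝ≥0} {n : ℕ}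
    (h₁ : (t : WithTop ℝ≥0) ≤ exitLevel U hc n θ₁ ω) (h₂ : (t : WithTop ℝ≥0) ≤ exitLevel U hc n θ₂ ω) :
    arg U hc θ₁ t ω ≤ arg U hc θ₂ t ω := by
  rw [arg_eq_argLevel hc h₁, arg_eq_argLevel hc h₂]
  exact argTrunc_mono hc (level_pos n) (level_le n) hθ ω t

/-- **Contraction for the radial Bessel flows**: `0 ≤ Y^{θ₂}ₜ - Y^{θ₁}ₜ ≤ θ₂ - θ₁` below both
lifetimes. [cite: Lawler2005, §1.11.2] -/
theorem arg_sub_arg_mem_Icc {θ₁ θ₂ : ℝ} (hθ : θ₁ ≤ θ₂) {ω : Ω} {t : ℝ≥0} {n : ℕ}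
    (h₁ : (t : WithTop ℝ≥0) ≤ exitLevel U hc n θ₁ ω) (h₂ : (t : WithTop ℝ≥0) ≤ exitLevel U hc n θ₂ ω) :
    arg U hc θ₂ t ω - arg U hc θ₁ t ω ∈ Icc 0 (θ₂ - θ₁) := by
  rw [arg_eq_argLevel hc h₁, arg_eq_argLevel hc h₂]
  exact sub_argTrunc_mem_Icc hc (level_pos n) (level_le n) hθ ω t

/-- **Top exits propagate upwards**: `θ₁ ≤ θ₂`, `θ₂` inside the level-`n` interval,
`TopAt n θ₁ → TopAt n θ₂` (and `σₙ(θ₂) ≤ σₙ(θ₁)`). [folklore] -/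
theorem topAt_mono {θ₁ θ₂ : ℝ} (hθ : θ₁ ≤ θ₂) {n : ℕ}
    (hθ₂ : θ₂ ∈ Ioo (2 * level n) (2 * Real.pi - 2 * level n)) {ω : Ω}
    (h : TopAt U hc n θ₁ ω) : TopAt U hc n θ₂ ω ∧ exitLevel U hc n θ₂ ω ≤ exitLevel U hc n θ₁ ω := by
  obtain ⟨s, hs, hys⟩ := h
  obtain ⟨s', hs's, hs', hy'⟩ := truncExit_le_of_top hc (level_pos n) (level_le n) hθ hθ₂ ω hs hys
  have hs'' : exitLevel U hc n θ₂ ω = s' := hs'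
  exact ⟨⟨s', hs', hy'⟩, by rw [hs, hs'']; exact WithTop.coe_le_coe.2 hs's⟩

/-- **Bottom exits propagate downwards**: `θ₁ ≤ θ₂`, `θ₁` inside the level-`n` interval,
`BotAt n θ₂ → BotAt n θ₁` (and `σₙ(θ₁) ≤ σₙ(θ₂)`). [folklore] -/
theorem botAt_anti {θ₁ θ₂ : ℝ} (hθ : θ₁ ≤ θ₂) {n : ℕ}
    (hθ₁ : θ₁ ∈ Ioo (2 * level n) (2 * Real.pi - 2 * level n)) {ω : Ω}
    (h : BotAt U hc n θ₂ ω) : BotAt U hc n θ₁ ω ∧ exitLevel U hc n θ₁ ω ≤ exitLevel U hc n θ₂ ω := by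
  obtain ⟨s, hs, hys⟩ := h
  obtain ⟨s', hs's, hs', hy'⟩ := truncExit_le_of_bot hc (level_pos n) (level_le n) hθ hθ₁ ω hs hys
  have hs'' : exitLevel U hc n θ₁ ω = s' := hs'
  exact ⟨⟨s', hs', hy'⟩, by rw [hs, hs'']; exact WithTop.coe_le_coe.2 hs's⟩

/-- **`{Y_T = 2π}` is increasing in the starting point**: `θ₁ ≤ θ₂ < 2π`,
`ExitsTop θ₁ → ExitsTop θ₂` (pathwise, one driving path). This is the monotonicity
`Q(θ₁) ⊆ Q(θ₂)` of LSW's sets read on the radial Bessel process.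
[cite: LawlerSchrammWernerEJP2002, §2] -/
theorem exitsTop_mono {θ₁ θ₂ : ℝ} (hθ : θ₁ ≤ θ₂) (hθ₂ : θ₂ ∈ Ioo 0 (2 * Real.pi)) {ω : Ω}
    (h : ExitsTop U hc θ₁ ω) : ExitsTop U hc θ₂ ω := by
  obtain ⟨N, hN⟩ := h
  obtain ⟨N₂, hN₂⟩ := eventually_mem_Ioo_level hθ₂
  exact ⟨max N N₂, fun n hn ↦ (topAt_mono hc hθ (hN₂ n ((le_max_right _ _).trans hn))
    (hN n ((le_max_left _ _).trans hn))).1⟩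

/-- **`{Y_T = 0}` is decreasing in the starting point**: `0 < θ₁ ≤ θ₂`,
`ExitsBot θ₂ → ExitsBot θ₁`. [cite: LawlerSchrammWernerEJP2002, §2] -/
theorem exitsBot_anti {θ₁ θ₂ : ℝ} (hθ : θ₁ ≤ θ₂) (hθ₁ : θ₁ ∈ Ioo 0 (2 * Real.pi)) {ω : Ω}
    (h : ExitsBot U hc θ₂ ω) : ExitsBot U hc θ₁ ω := by
  obtain ⟨N, hN⟩ := h
  obtain ⟨N₁, hN₁⟩ := eventually_mem_Ioo_level hθ₁
  exact ⟨max N N₁, fun n hn ↦ (botAt_anti hc hθ (hN₁ n ((le_max_right _ _).trans hn))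
    (hN n ((le_max_left _ _).trans hn))).1⟩

end Maximal

end RadialLoewner

end Literature.Probability.RandomPlanarGeometry
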